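import Summits.CriticalPhenomena.PercolationContinuityZ3.Theorems.Transplant.GrigorchukLamplighterCayleyClasses
import Summits.CriticalPhenomena.PercolationContinuityZ3.Theorems.Transplant.GrigorchukCriticalProbLtOne
import Summits.CriticalPhenomena.PercolationContinuityZ3.Theorems.Transplant.GrigorchukSectionLifts
import HarnessLib

/-!
# LABEL RIGIDITY of the standard Cayley graph `Cay(𝔊; a, b, c, d)` of the first Grigorchuk group: every graph automorphism preserves each
# edge label `a, b, c, d` (the O14 census restricted to the tree letters)

builds on p205010 (kernel theorem, internal audit signed; external expert review pending) — nothing in this file uses p205010; graph theory of ONE Cayley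
graph, no percolation statement, nothing about any `@[conjecture]` (in particular nothing about `BenjaminiSchramm1996_conj4_endState` or the residue node;
`θ(p_c)` on `Cay(𝔊; a, b, c, d)` is NOT proved in the tree or in print).  Lane `prim-bschramm`, seat `prim-bschramm-p3` gen 39 (DESIGN OWNER;
`P3-NILPOTENT.md` §32).  Helper file (`--supports stmt-CriticalPhenomena-4575 --as helper`).  No new model of `𝔊`, no instance, no notation; the letters `Letter.toG` are p614903's («GrigorchukSectionLifts»).

WHY.  After V164 the lane's recommended next witness of record for the open residue node is `Cay(𝔊; a, b, c, d)` (VERDICTS :439 (b4), rider R3: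
«no door the lane can name; `Aut(Cay(𝔊; S))` unclassified»).  This file and its sequel «GrigorchukCayleyAutGroup» classify `Aut(Cay(𝔊; a, b, c, d))`:
it is `𝔊` itself (every automorphism is a left translation), hence TORSION — so no node or route of the lane has its input on this graph for ANY group of
automorphisms (sequel).  THE CENSUS (the adjacency-defined predicates `TriE`, `SqT`, `IsT`, `IsA`, `AltRet`, `Alt8`, `IsBC`, `Alt16` and their invariance
under `G ≃g G` are those of «GrigorchukLamplighterCayleyClasses» §2, stated there for every simple graph and IMPORTED, not restated):
* `TriE (u, u·y)` iff `y ∈ {b, c, d}` (the `K₄` on `u·{1, b, c, d}`; no product of two letters is `a` — finite model p599763 on `000`/`100`);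
* no `T`-cornered square through an `a`-edge (`a t y ≠ t′`), so `IsA` = the letter `a`, `IsT` = `{b, c, d}`;
* `Alt8` holds at `d`-edges (`(d a)⁴ = 1`, p606146) and fails at `b`/`c`-edges (the 54 certified words `alt8_ne_one`, p599763);
* `Alt16` holds at `c`-edges (`(c a)⁸ = 1`) and fails at `b`-edges (the 128 certified words `alt16_ne_one`).
MAIN THEOREM `stdCay_label_rigid (φ : stdCay ≃g stdCay) (u) : φ (u·a) = φ u·a ∧ φ (u·b) = φ u·b ∧ φ (u·c) = φ u·c ∧ φ (u·d) = φ u·d`.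
Other generating sets of `𝔊` are NOT treated (their automorphism groups stay unclassified).
[cite: Grigorchuk1980, relations a² = b² = c² = d² = bcd = 1, (ad)⁴ = 1] [cite: BenjaminiSchramm1996, §2 (Cayley graphs)] [cite: BartholdiErschler2012, §3.1 (wreath recursion)]
-/

noncomputable section

namespace Summit.CriticalPhenomena.PercolationContinuityZ3.Theorems.Transplant

namespace Grigorchuk

open SimpleGraph
open scoped Classical

/-! ### §1 The graph, the letters, adjacency -/

/-- **The standard Cayley graph `Cay(𝔊; a, b, c, d)`** of the first Grigorchuk group (right Cayley graph of `{a, b, c, d}`) — an `abbrev` for, and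
definitionally EQUAL to, the graph `mulCayley ↑{aG, bG, cG, dG}` of «GrigorchukCriticalProbLtOne» p607347 / «GrigorchukResidueScope» p625451 /
«GrigorchukCayleyAutNotVirtuallyNilpotent» p621086 (`stdCay_eq` below, `rfl`); reducible, so the tree's `LocallyFinite` instance for `mulCayley` of a
finite set is found through it. [cite: Grigorchuk1980, definition of a, b, c, d] -/
abbrev stdCay : SimpleGraph ↥grigorchukGroup := mulCayley (↑({aG, bG, cG, dG} : Finset ↥grigorchukGroup) : Set ↥grigorchukGroup)

/-- `stdCay` IS the graph `mulCayley ↑{aG, bG, cG, dG}` of p607347 / p625451 / p621086 (by `rfl`). [folklore] -/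
theorem stdCay_eq : stdCay = mulCayley (↑({aG, bG, cG, dG} : Finset ↥grigorchukGroup) : Set ↥grigorchukGroup) := rfl

/-- The four letters (p614903's `Letter.toG`, by cases) name `a, b, c, d`. [folklore] -/
theorem toG_letters : Letter.toG .a = aG ∧ Letter.toG (.x .b) = bG ∧ Letter.toG (.x .c) = cG ∧ Letter.toG (.x .d) = dG := ⟨rfl, rfl, rfl, rfl⟩

/-- **The Klein table in `𝔊`**: `b c = d`, `c b = d`, `b d = c`, `d b = c`, `c d = b`, `d c = b`. [cite: Grigorchuk1980, bcd = 1, {1,b,c,d} ≅ (ℤ/2)²] -/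
theorem kleinG : bG * cG = dG ∧ cG * bG = dG ∧ bG * dG = cG ∧ dG * bG = cG ∧ cG * dG = bG ∧ dG * cG = bG := by
  refine ⟨Subtype.ext ?_, Subtype.ext ?_, Subtype.ext ?_, Subtype.ext ?_, Subtype.ext ?_, Subtype.ext ?_⟩
  · change genB * genC = genD; exact (V4.toPerm_mul .b .c).symm
  · change genC * genB = genD; exact (V4.toPerm_mul .c .b).symm
  · change genB * genD = genC; exact (V4.toPerm_mul .b .d).symm
  · change genD * genB = genC; exact (V4.toPerm_mul .d .b).symm
  · change genC * genD = genB; exact (V4.toPerm_mul .c .d).symm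
  · change genD * genC = genB; exact (V4.toPerm_mul .d .c).symm

/-- The letters are their own inverses (p614903's `Letter.toG_mul_self`). [cite: Grigorchuk1980, a² = b² = c² = d² = 1] -/
theorem toG_inv (y : Letter) : (Letter.toG y)⁻¹ = Letter.toG y := inv_eq_of_mul_eq_one_right (Letter.toG_mul_self y)

/-- The product of the elements named by a list of letters. [folklore] -/
def prodG : List Letter → ↥grigorchukGroup
  | [] => 1
  | y :: ys => Letter.toG y * prodG ys

/-- The underlying permutation of `prodG ys` is the word's `evalPerm`. [folklore] -/
theorem coe_prodG (ys : List Letter) : ((prodG ys : ↥grigorchukGroup) : Equiv.Perm Ray) = evalPerm ys := by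
  induction ys with
  | nil => rfl
  | cons y ys ih => rw [prodG, Subgroup.coe_mul, Letter.coe_toG, ih, evalPerm_cons]

/-- **The Boolean separation test**: the finite models of two words differ on `000` or on `100`. [folklore] -/
def sepG (ys ys' : List Letter) : Bool :=
  (evalModel ys [false, false, false] != evalModel ys' [false, false, false]) ||
    (evalModel ys [true, false, false] != evalModel ys' [true, false, false])

/-- **Soundness of the separation test**: `sepG ys ys′ ⟹ prodG ys ≠ prodG ys′` (finite model p599763, SOUND direction only). [folklore] -/
theorem prodG_ne_of_sep {ys ys' : List Letter} (h : sepG ys ys' = true) : prodG ys ≠ prodG ys' := by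
  intro e
  have e' : evalPerm ys = evalPerm ys' := by rw [← coe_prodG, ← coe_prodG, e]
  simp only [sepG, Bool.or_eq_true, bne_iff_ne, ne_eq] at h
  rcases h with h | h
  · exact ne_of_evalModel_ne h e'
  · exact ne_of_evalModel_ne h e'

/-- **No product of two letters is `a`** (no triangle through an `a`-edge). [folklore] -/
theorem letter_mul_ne_aG (y z : Letter) : Letter.toG y * Letter.toG z ≠ aG := by
  have h : prodG [y, z] ≠ prodG [.a] := prodG_ne_of_sep (by rcases y with _ | ⟨_ | _ | _⟩ <;> rcases z with _ | ⟨_ | _ | _⟩ <;> decide)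
  simpa only [prodG, mul_one, toG_letters.1] using h

/-- **`a t y ≠ t′` for tree letters `t, t′` and any letter `y`** (no square through an `a`-edge with two tree-letter corners). [folklore] -/
theorem aG_tree_letter_ne (t y t' : Letter) (ht : t.isTree = true) (ht' : t'.isTree = true) :
    aG * Letter.toG t * Letter.toG y ≠ Letter.toG t' := by
  have h : prodG [.a, t, y] ≠ prodG [t'] := prodG_ne_of_sep (by
    revert ht ht'
    rcases t with _ | ⟨_ | _ | _⟩ <;> rcases t' with _ | ⟨_ | _ | _⟩ <;> intro ht ht' <;>
      first | exact absurd ht (by decide) | exact absurd ht' (by decide) | (rcases y with _ | ⟨_ | _ | _⟩ <;> decide))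
  simpa only [prodG, mul_one, toG_letters.1, mul_assoc] using h

/-- **The four letters are `≠ 1`.** [folklore] -/
theorem toG_ne_one (y : Letter) : Letter.toG y ≠ 1 := by
  have h : prodG [y] ≠ prodG [] := prodG_ne_of_sep (by rcases y with _ | ⟨_ | _ | _⟩ <;> decide)
  simpa only [prodG, mul_one] using h

/-- `x ∈ {a, b, c, d}` iff `x` is named by a letter. [folklore] -/
theorem mem_gens_iff {x : ↥grigorchukGroup} : x ∈ ({aG, bG, cG, dG} : Finset ↥grigorchukGroup) ↔ ∃ y : Letter, x = Letter.toG y := by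
  simp only [Finset.mem_insert, Finset.mem_singleton]
  constructor
  · rintro (rfl | rfl | rfl | rfl)
    exacts [⟨.a, rfl⟩, ⟨.x .b, rfl⟩, ⟨.x .c, rfl⟩, ⟨.x .d, rfl⟩]
  · rintro ⟨y, rfl⟩
    rcases y with _ | ⟨_ | _ | _⟩
    exacts [Or.inl rfl, Or.inr (Or.inl rfl), Or.inr (Or.inr (Or.inl rfl)), Or.inr (Or.inr (Or.inr rfl))]

/-- **Neighbours are right multiples by the four letters.** [cite: BenjaminiSchramm1996, §2 (Cayley graphs)] -/
theorem stdCay_adj_iff {u w : ↥grigorchukGroup} : stdCay.Adj u w ↔ ∃ y : Letter, w = u * Letter.toG y := by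
  constructor
  · intro h
    obtain ⟨x, -, hx, rfl⟩ := CayleyCosets.exists_letter_of_adj ({aG, bG, cG, dG} : Finset ↥grigorchukGroup) h
    rcases hx with hx | hx
    · obtain ⟨y, rfl⟩ := mem_gens_iff.1 hx
      exact ⟨y, rfl⟩
    · obtain ⟨y, hy⟩ := mem_gens_iff.1 hx
      refine ⟨y, ?_⟩
      rw [← toG_inv, ← hy, inv_inv]
  · rintro ⟨y, rfl⟩
    exact CayleyCosets.adj_mul_letter ({aG, bG, cG, dG} : Finset ↥grigorchukGroup) (Or.inl (mem_gens_iff.2 ⟨y, rfl⟩)) (toG_ne_one y)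

/-- `u — u·y` for every letter `y`. [folklore] -/
theorem stdCay_adj_mul (u : ↥grigorchukGroup) (y : Letter) : stdCay.Adj u (u * Letter.toG y) := stdCay_adj_iff.2 ⟨y, rfl⟩

/-! ### §2 The census: triangles and `T`-cornered squares -/

/-- **Triangles sit exactly on the tree letters**: `TriE (u, u·y)` iff `y ∈ {b, c, d}`. [folklore] -/
theorem triE_iff_std (u : ↥grigorchukGroup) (y : Letter) : TriE stdCay u (u * Letter.toG y) ↔ y.isTree = true := by
  constructor
  · rintro ⟨w, h1, h2⟩
    obtain ⟨z, rfl⟩ := stdCay_adj_iff.1 h1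
    obtain ⟨z', hz'⟩ := stdCay_adj_iff.1 h2
    -- `z = y z'`, so `y = z z'⁻¹ = z z'`
    have e1 : Letter.toG z = Letter.toG y * Letter.toG z' := mul_left_cancel (by rw [← mul_assoc]; exact hz')
    have e : Letter.toG y = Letter.toG z * Letter.toG z' := by rw [e1, mul_assoc, Letter.toG_mul_self, mul_one]
    rcases y with _ | ⟨_ | _ | _⟩
    · exact absurd e.symm (letter_mul_ne_aG z z')
    · rfl
    · rfl
    · rfl
  · intro hy
    rcases y with _ | ⟨_ | _ | _⟩
    · exact absurd hy (by decide)
    · refine ⟨u * cG, ?_, ?_⟩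
      · exact toG_letters.2.2.1 ▸ stdCay_adj_mul u (.x .c)
      · have : u * cG = u * bG * dG := by rw [mul_assoc, kleinG.2.2.1]
        rw [toG_letters.2.1, this]; exact toG_letters.2.2.2 ▸ stdCay_adj_mul _ (.x .d)
    · refine ⟨u * bG, ?_, ?_⟩
      · exact toG_letters.2.1 ▸ stdCay_adj_mul u (.x .b)
      · have : u * bG = u * cG * dG := by rw [mul_assoc, kleinG.2.2.2.2.1]
        rw [toG_letters.2.2.1, this]; exact toG_letters.2.2.2 ▸ stdCay_adj_mul _ (.x .d)
    · refine ⟨u * bG, ?_, ?_⟩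
      · exact toG_letters.2.1 ▸ stdCay_adj_mul u (.x .b)
      · have : u * bG = u * dG * cG := by rw [mul_assoc, kleinG.2.2.2.2.2]
        rw [toG_letters.2.2.2, this]; exact toG_letters.2.2.1 ▸ stdCay_adj_mul _ (.x .c)

/-- **No `T`-cornered square through an `a`-edge** (`a t y ≠ t′`). [folklore] -/
theorem not_sqT_aG (u : ↥grigorchukGroup) : ¬ SqT stdCay u (u * aG) := by
  rintro ⟨w, z, h1, h2, h3, h4, h5⟩
  obtain ⟨t, rfl⟩ := stdCay_adj_iff.1 h1
  obtain ⟨t', rfl⟩ := stdCay_adj_iff.1 h3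
  obtain ⟨y, hy⟩ := stdCay_adj_iff.1 h5
  have ht := (triE_iff_std _ t).1 h2
  have ht' := (triE_iff_std _ t').1 h4
  refine aG_tree_letter_ne t y t' ht ht' ?_
  have := hy; rw [mul_assoc u, mul_assoc u] at this
  exact (mul_left_cancel this).symm

/-- **The classes of the four edges at a vertex**: `IsA` at `a`, `IsT` at `b, c, d`. [folklore] -/
theorem classes_std (u : ↥grigorchukGroup) :
    IsA stdCay u (u * aG) ∧ ∀ y : Letter, y.isTree = true → IsT stdCay u (u * Letter.toG y) := by
  refine ⟨⟨toG_letters.1 ▸ stdCay_adj_mul u .a, fun h => ?_, not_sqT_aG u⟩, fun y hy => ⟨stdCay_adj_mul u y, (triE_iff_std u y).2 hy⟩⟩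
  have h' : TriE stdCay u (u * Letter.toG .a) := toG_letters.1.symm ▸ h
  exact absurd ((triE_iff_std u .a).1 h') (by decide)

/-- **An `A`-neighbour is `u·a`.** [folklore] -/
theorem eq_of_isA_std {u w : ↥grigorchukGroup} (h : IsA stdCay u w) : w = u * aG := by
  obtain ⟨hadj, hntri, -⟩ := h
  obtain ⟨y, rfl⟩ := stdCay_adj_iff.1 hadj
  rcases y with _ | ⟨v⟩
  · rfl
  · exact absurd ((triE_iff_std u (.x v)).2 rfl) hntri

/-- **A `T`-neighbour is `u·t` for a tree letter.** [folklore] -/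
theorem exists_of_isT_std {u w : ↥grigorchukGroup} (h : IsT stdCay u w) : ∃ y : Letter, y.isTree = true ∧ w = u * Letter.toG y := by
  obtain ⟨hadj, htri⟩ := h
  obtain ⟨y, rfl⟩ := stdCay_adj_iff.1 hadj
  exact ⟨y, (triE_iff_std u y).1 htri, rfl⟩

/-! ### §3 The alternating walks: `d` versus `b, c`, then `c` versus `b` -/

/-- The alternating product of a list of letters: `t₁ a t₂ a ⋯ t_n a`. [folklore] -/
def altProdG : List Letter → ↥grigorchukGroup
  | [] => 1
  | t :: ts => Letter.toG t * aG * altProdG ts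

/-- The alternating word of a list of letters: `t₁ a t₂ a ⋯ t_n a`. [folklore] -/
def altWord : List Letter → List Letter
  | [] => []
  | t :: ts => t :: .a :: altWord ts

/-- The underlying permutation of an alternating product is the alternating word's `evalPerm`. [folklore] -/
theorem coe_altProdG (ts : List Letter) : ((altProdG ts : ↥grigorchukGroup) : Equiv.Perm Ray) = evalPerm (altWord ts) := by
  induction ts with
  | nil => rfl
  | cons t ts ih =>
    rw [altProdG, altWord, Subgroup.coe_mul, Subgroup.coe_mul, Letter.coe_toG, ih, evalPerm_cons, evalPerm_cons, mul_assoc]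
    rfl

/-- **Building an alternating return along powers of `t a`.** [folklore] -/
theorem altRet_pow_std {P : ↥grigorchukGroup → ↥grigorchukGroup → Prop} {t : Letter} (hT : ∀ v : ↥grigorchukGroup, P v (v * Letter.toG t)) :
    ∀ (n : ℕ) (x : ↥grigorchukGroup), AltRet stdCay P n x (x * (Letter.toG t * aG) ^ n) := by
  intro n
  induction n with
  | zero => intro x; rw [pow_zero, mul_one]; rfl
  | succ n ih =>
    intro x
    refine ⟨x * Letter.toG t, x * Letter.toG t * aG, hT x, (classes_std (x * Letter.toG t)).1, ?_⟩
    have e : x * (Letter.toG t * aG) ^ (n + 1) = x * Letter.toG t * aG * (Letter.toG t * aG) ^ n := by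
      rw [pow_succ', ← mul_assoc, ← mul_assoc]
    rw [e]
    exact ih _

/-- **Reading the letters off an alternating return**: if `P ⊆ IsT` and `P` at an edge `v — v·t` forces `Q t`, then `AltRet P n w y` gives
`y = w · (t₁ a ⋯ t_n a)` with `n` letters all satisfying `Q`. [folklore] -/
theorem altRet_letters_std {P : ↥grigorchukGroup → ↥grigorchukGroup → Prop} (hP : ∀ u v, P u v → IsT stdCay u v) {Q : Letter → Prop}
    (hQ : ∀ (v : ↥grigorchukGroup) (t : Letter), P v (v * Letter.toG t) → Q t) :
    ∀ (n : ℕ) {w y : ↥grigorchukGroup}, AltRet stdCay P n w y →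
      ∃ ts : List Letter, ts.length = n ∧ (∀ t ∈ ts, Q t) ∧ y = w * altProdG ts := by
  intro n
  induction n with
  | zero =>
    intro w y h
    exact ⟨[], rfl, fun _ h => by simp at h, by rw [altProdG, mul_one]; exact h.symm⟩
  | succ n ih =>
    rintro w y ⟨v, x, h1, h2, h3⟩
    obtain ⟨t, -, rfl⟩ := exists_of_isT_std (hP _ _ h1)
    have hx := eq_of_isA_std h2
    subst hx
    obtain ⟨ts, hlen, hQts, rfl⟩ := ih h3
    refine ⟨t :: ts, by rw [List.length_cons, hlen], ?_, by rw [altProdG, ← mul_assoc, ← mul_assoc]⟩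
    intro t' ht'
    rw [List.mem_cons] at ht'
    rcases ht' with rfl | ht'
    · exact hQ w _ h1
    · exact hQts _ ht'

/-- `(d a)⁴ = 1` and `(c a)⁸ = 1` in `𝔊` (p606146's `da_pow_four`, and `(a c)⁸ = 1` conjugated by `a = a⁻¹`). [cite: Grigorchuk1980, (ad)⁴ = 1] -/
theorem dG_aG_pow_four_and : (dG * aG) ^ 4 = 1 ∧ (cG * aG) ^ 8 = 1 := by
  refine ⟨Subtype.ext ?_, Subtype.ext ?_⟩
  · change (genD * genA) ^ 4 = 1; exact da_pow_four
  · change (genC * genA) ^ 8 = 1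
    have ha : genA * genA = 1 := Equiv.ext fun x => flipAt_involutive 0 x
    have ha' : genA⁻¹ = genA := inv_eq_of_mul_eq_one_right ha
    have e : genC * genA = genA⁻¹ * (genA * genC) * genA⁻¹⁻¹ := by rw [inv_inv, ha', ← mul_assoc, ha, one_mul]
    rw [e, conj_pow, ac_pow_eight, mul_one, inv_inv, inv_mul_cancel]

/-- **`d`-edges lie on an alternating `T/A` closed 8-walk** (`(d a)⁴ = 1`). [folklore] -/
theorem alt8_dG (u : ↥grigorchukGroup) : Alt8 stdCay u (u * dG) := by
  refine ⟨toG_letters.2.2.2 ▸ (classes_std u).2 (.x .d) rfl, u * dG * aG, (classes_std _).1, ?_⟩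
  have h := altRet_pow_std (P := IsT stdCay) (t := .x .d) (fun v => (classes_std v).2 (.x .d) rfl) 3 (u * dG * aG)
  have e : u * dG * aG * (Letter.toG (.x .d) * aG) ^ 3 = u := by
    rw [toG_letters.2.2.2, mul_assoc u, mul_assoc u, ← pow_succ', dG_aG_pow_four_and.1, mul_one]
  rwa [e] at h

/-- **`b`- and `c`-edges lie on NO alternating `T/A` closed 8-walk** (the 54 certified words of p599763). [folklore] -/
theorem not_alt8_bcG (u : ↥grigorchukGroup) {y : Letter} (hy : y.isBC = true) : ¬ Alt8 stdCay u (u * Letter.toG y) := by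
  rintro ⟨-, w, hA, hret⟩
  have hw := eq_of_isA_std hA
  subst hw
  obtain ⟨ts, hlen, htree, hu⟩ :=
    altRet_letters_std (P := IsT stdCay) (fun _ _ h => h) (Q := fun t => t.isTree = true) (fun v t h => (triE_iff_std v t).1 h.2) 3 hret
  obtain ⟨t₁, t₂, t₃, rfl⟩ := List.length_eq_three.1 hlen
  refine alt8_ne_one y t₁ t₂ t₃ hy (htree t₁ (by simp)) (htree t₂ (by simp)) (htree t₃ (by simp)) ?_
  -- the closed walk is the relation `y a t₁ a t₂ a t₃ a = 1`
  have h2 : u * altProdG (y :: [t₁, t₂, t₃]) = u * 1 := by rw [mul_one, altProdG, ← mul_assoc, ← mul_assoc]; exact hu.symm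
  have h3 : altProdG (y :: [t₁, t₂, t₃]) = 1 := mul_left_cancel h2
  have h4 := congrArg (fun g : ↥grigorchukGroup => (g : Equiv.Perm Ray)) h3
  simp only [coe_altProdG, Subgroup.coe_one] at h4
  exact h4

/-- **`c`-edges lie on an alternating `(T ∧ ¬Alt8)/A` closed 16-walk** (`(c a)⁸ = 1`). [folklore] -/
theorem alt16_cG (u : ↥grigorchukGroup) : Alt16 stdCay u (u * cG) := by
  have hBC : ∀ v : ↥grigorchukGroup, IsBC stdCay v (v * Letter.toG (.x .c)) := fun v =>
    ⟨(classes_std v).2 (.x .c) rfl, not_alt8_bcG v (y := .x .c) rfl⟩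
  refine ⟨toG_letters.2.2.1 ▸ hBC u, u * cG * aG, (classes_std _).1, ?_⟩
  have h := altRet_pow_std (P := IsBC stdCay) (t := .x .c) hBC 7 (u * cG * aG)
  have e : u * cG * aG * (Letter.toG (.x .c) * aG) ^ 7 = u := by
    rw [toG_letters.2.2.1, mul_assoc u, mul_assoc u, ← pow_succ', dG_aG_pow_four_and.2, mul_one]
  rwa [e] at h

/-- **`b`-edges lie on NO alternating `(T ∧ ¬Alt8)/A` closed 16-walk** (the 128 certified words of p599763). [folklore] -/
theorem not_alt16_bG (u : ↥grigorchukGroup) : ¬ Alt16 stdCay u (u * bG) := by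
  rintro ⟨-, w, hA, hret⟩
  have hw := eq_of_isA_std hA
  subst hw
  have hQ : ∀ (v : ↥grigorchukGroup) (t : Letter), IsBC stdCay v (v * Letter.toG t) → t.isBC = true := by
    intro v t ⟨hT, hn8⟩
    have ht := (triE_iff_std v t).1 hT.2
    rcases t with _ | ⟨_ | _ | _⟩
    · exact absurd ht (by decide)
    · rfl
    · rfl
    · exact absurd (toG_letters.2.2.2 ▸ alt8_dG v) hn8
  obtain ⟨ts, hlen, hbc, hu⟩ := altRet_letters_std (P := IsBC stdCay) (fun _ _ h => h.1) (Q := fun t => t.isBC = true) hQ 7 hret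
  obtain ⟨t₂, ts, rfl⟩ := List.exists_cons_of_length_eq_add_one hlen
  obtain ⟨t₃, ts, rfl⟩ := List.exists_cons_of_length_eq_add_one (Nat.succ.inj hlen)
  obtain ⟨t₄, ts, rfl⟩ := List.exists_cons_of_length_eq_add_one (Nat.succ.inj (Nat.succ.inj hlen))
  obtain ⟨t₅, ts, rfl⟩ := List.exists_cons_of_length_eq_add_one (Nat.succ.inj (Nat.succ.inj (Nat.succ.inj hlen)))
  obtain ⟨t₆, ts, rfl⟩ := List.exists_cons_of_length_eq_add_one (Nat.succ.inj (Nat.succ.inj (Nat.succ.inj (Nat.succ.inj hlen))))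
  obtain ⟨t₇, ts, rfl⟩ := List.exists_cons_of_length_eq_add_one
    (Nat.succ.inj (Nat.succ.inj (Nat.succ.inj (Nat.succ.inj (Nat.succ.inj hlen)))))
  obtain ⟨t₈, ts, rfl⟩ := List.exists_cons_of_length_eq_add_one
    (Nat.succ.inj (Nat.succ.inj (Nat.succ.inj (Nat.succ.inj (Nat.succ.inj (Nat.succ.inj hlen))))))
  obtain rfl : ts = [] := List.eq_nil_of_length_eq_zero
    (Nat.succ.inj (Nat.succ.inj (Nat.succ.inj (Nat.succ.inj (Nat.succ.inj (Nat.succ.inj (Nat.succ.inj hlen)))))))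
  refine alt16_ne_one t₂ t₃ t₄ t₅ t₆ t₇ t₈ (hbc t₂ (by simp)) (hbc t₃ (by simp)) (hbc t₄ (by simp)) (hbc t₅ (by simp))
    (hbc t₆ (by simp)) (hbc t₇ (by simp)) (hbc t₈ (by simp)) ?_
  -- the closed walk is the relation `b a t₂ a ⋯ t₈ a = 1`
  have h2 : u * altProdG (.x .b :: [t₂, t₃, t₄, t₅, t₆, t₇, t₈]) = u * 1 := by
    rw [mul_one, altProdG, toG_letters.2.1, ← mul_assoc, ← mul_assoc]; exact hu.symm
  have h3 : altProdG (.x .b :: [t₂, t₃, t₄, t₅, t₆, t₇, t₈]) = 1 := mul_left_cancel h2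
  have h4 := congrArg (fun g : ↥grigorchukGroup => (g : Equiv.Perm Ray)) h3
  simp only [coe_altProdG, Subgroup.coe_one] at h4
  exact h4

/-! ### §4 Label rigidity -/

/-- **LABEL RIGIDITY OF `Cay(𝔊; a, b, c, d)`.**  Every graph automorphism `φ` satisfies `φ (u·a) = φ u · a`, `φ (u·b) = φ u · b`, `φ (u·c) = φ u · c` and
`φ (u·d) = φ u · d` at every vertex `u` — the edge labels are intrinsic: `a` = no triangle (and no `T`-cornered square), `{b,c,d}` = in a triangle, `d` = on an
alternating 8-walk, `c` = on an alternating 16-walk, `b` = neither.  Lane record `P3-NILPOTENT.md` §32. [cite: Grigorchuk1980, relations of 𝔊]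
[cite: BenjaminiSchramm1996, §2 (Cayley graphs)] -/
theorem stdCay_label_rigid (φ : stdCay ≃g stdCay) (u : ↥grigorchukGroup) :
    φ (u * aG) = φ u * aG ∧ φ (u * bG) = φ u * bG ∧ φ (u * cG) = φ u * cG ∧ φ (u * dG) = φ u * dG := by
  obtain ⟨hA, hT⟩ := classes_std u
  refine ⟨?_, ?_, ?_, ?_⟩
  · -- `a`: the image edge is of class `A`
    exact eq_of_isA_std ((isA_map_iff φ).2 hA)
  · -- `b`: class `T`, not `Alt8`, not `Alt16`
    obtain ⟨y, hy, e⟩ := exists_of_isT_std ((isT_map_iff φ).2 (toG_letters.2.1 ▸ hT (.x .b) rfl))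
    have hn8 : ¬ Alt8 stdCay (φ u) (φ u * Letter.toG y) :=
      e ▸ (alt8_map_iff φ).not.2 (toG_letters.2.1 ▸ not_alt8_bcG u (y := .x .b) rfl)
    have hn16 : ¬ Alt16 stdCay (φ u) (φ u * Letter.toG y) := e ▸ (alt16_map_iff φ).not.2 (not_alt16_bG u)
    rw [e]
    rcases y with _ | ⟨_ | _ | _⟩
    · exact absurd hy (by decide)
    · rfl
    · exact absurd (toG_letters.2.2.1 ▸ alt16_cG (φ u)) hn16
    · exact absurd (toG_letters.2.2.2 ▸ alt8_dG (φ u)) hn8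
  · -- `c`: class `T`, not `Alt8`, `Alt16`
    obtain ⟨y, hy, e⟩ := exists_of_isT_std ((isT_map_iff φ).2 (toG_letters.2.2.1 ▸ hT (.x .c) rfl))
    have hn8 : ¬ Alt8 stdCay (φ u) (φ u * Letter.toG y) :=
      e ▸ (alt8_map_iff φ).not.2 (toG_letters.2.2.1 ▸ not_alt8_bcG u (y := .x .c) rfl)
    have h16 : Alt16 stdCay (φ u) (φ u * Letter.toG y) := e ▸ (alt16_map_iff φ).2 (alt16_cG u)
    rw [e]
    rcases y with _ | ⟨_ | _ | _⟩
    · exact absurd hy (by decide)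
    · exact absurd h16 (toG_letters.2.1 ▸ not_alt16_bG (φ u))
    · rfl
    · exact absurd (toG_letters.2.2.2 ▸ alt8_dG (φ u)) hn8
  · -- `d`: class `T`, `Alt8`
    obtain ⟨y, hy, e⟩ := exists_of_isT_std ((isT_map_iff φ).2 (toG_letters.2.2.2 ▸ hT (.x .d) rfl))
    have h8 : Alt8 stdCay (φ u) (φ u * Letter.toG y) := e ▸ (alt8_map_iff φ).2 (alt8_dG u)
    rw [e]
    rcases y with _ | ⟨_ | _ | _⟩
    · exact absurd hy (by decide)
    · exact absurd h8 (not_alt8_bcG (φ u) (y := .x .b) rfl)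
    · exact absurd h8 (not_alt8_bcG (φ u) (y := .x .c) rfl)
    · rfl

/-- **Corollary: every automorphism commutes with right multiplication by each of the four letters.** [folklore] -/
theorem stdCay_aut_mul_letter (φ : stdCay ≃g stdCay) (u : ↥grigorchukGroup) (y : Letter) : φ (u * Letter.toG y) = φ u * Letter.toG y := by
  obtain ⟨ha, hb, hc, hd⟩ := stdCay_label_rigid φ u
  rcases y with _ | ⟨_ | _ | _⟩
  exacts [ha, hb, hc, hd]

end Grigorchuk

end Summit.CriticalPhenomena.PercolationContinuityZ3.Theorems.Transplant
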